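import Literature.MathematicalPhysics.QuantumFieldTheory.Balaban1983to89.B9Eq386LipschitzH1Uniform
import Literature.MathematicalPhysics.QuantumFieldTheory.Balaban1983to89.B9Eq368RLipschitzUniform
import Literature.MathematicalPhysics.QuantumFieldTheory.Balaban1983to89.B9Eq368ProjectionRemainder
import Literature.MathematicalPhysics.QuantumFieldTheory.Balaban1983to89.B9Eq373DerivativeRemainderL2

/-!
# `Balaban1983to89.B9Eq3153FrakGLipschitzUniform` — T. Bałaban, *Propagators for lattice gauge theories in a background field*, Commun. Math. Phys.
# **99** (1985) 389–434 [Balaban1985BackgroundPropagators] (3.153) p. 426 / (3.147) p. 425 with Thm 3.4 p. 400, (3.86) p. 407 and Thm 3.11 p. 416: THE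
# pub-balaban NE9 CHAIN'S `𝔊(U) = G₁ − H₁QG₁ − G₁DRD*G₁` IS LIPSCHITZ IN THE BACKGROUND AT THE FLAT POINT WITH `C₃, ε₈` INDEPENDENT OF THE VOLUME —
# `∃ C₃ ε₈ > 0` BEFORE `∀ m`: `‖𝔊(U)x − 𝔊(1)x‖ ≤ C₃·ε·‖x‖` for `‖U(b) − 1‖ ≤ ε ≤ ε₈` on EVERY lattice `TSite d (L·m)`

statement-level skeleton of published theorems with citation tags; proofs where landed; nothing here is a claim about the Yang–Mills mass gap

PDF held: `paper:balaban1985-cmp99-background-propagators` (journal page = PDF page + 388), pp. 400, 407, 416, 425–426 read by this seat (2026-08-22; text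
layer p0012, p0019, p0028, p0037–p0038).

THE PRINT (verbatim).  p. 426, (3.153): *«… = G₁ − G₁DRD*G₁ − G₁Q*(QG₁Q*)⁻¹QG₁ = G₁𝔓* = 𝔓G₁. (3.153)»* (print's `G₁𝔓*`; the tree's name for this operator
is `𝔊`, `B11Eq111FrakG`); p. 400, the paragraph after Thm 3.4: *«In fact we prove quantitative statements which are more precise, describing these analytic
extensions as small perturbations of the operators depending on U only»*; p. 416, Thm 3.11: *«for M sufficiently large and α₀ sufficiently small»* (reader's
gloss, not print: a smallness that is not a function of the volume).

WHY THIS FILE (cell context).  The NE9 owner's `B9Eq3153FrakGLipschitz.exists_lipschitz_frakG_at_flat` (t4-ne9-p1 gen 81, INTENT-2 (Q3)) closes the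
owner's Lipschitz batch at a FIXED lattice: `C₃, ε₈` see the volume through its five per-lattice inputs (`norm_G1_le_of_small_field`,
`exists_H1_frakG_bound_of_small_field`, `exists_lipschitz_G1_H1_at_flat`, `exists_RofU_sub_flat_linear`, `CQ = …√(c₁·#Bond/c₀)…`) and the abstract
`‖Q(1)‖`.  Their volume-free twins are ALL in the tree: NE9 leaf-03's `B9Thm311SmallFieldClosedUniform.norm_G1_le_of_small_field_uniform` and
`B9Eq3126H1BoundUniform.exists_H1_frakG_bound_of_small_field_uniform`, this lineage's `B9Eq386LipschitzH1Uniform.exists_lipschitz_G1_H1_at_flat_uniform`,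
`B9Eq368RLipschitzUniform.exists_RofU_sub_flat_linear_uniform`, `B9Eq383QSemiLocal.norm_QtorusW_sub_flat_le_local`, and `B9Eq315QFlatNorm.norm_QtorusW_one_le`.
This file is the owner's proof with these re-plugged and `m` INSIDE — the last item (Q3′) of the volume-free Lipschitz batch: the chain's operator letters
`Δ_a(U)`, `G₁(U)`, `H₁(U)`, `R(U)`, `𝔊(U)` are all Lipschitz at the flat point with constants and radii that are numbers of `d, L, η, a, c₀, c₁, M_φ, M_φ′, C_τ`.

WHAT IS PROVED (sorry-free; 0 `def`; no inequality of the paper asserted).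
* **`exists_lipschitz_frakG_at_flat_uniform`** — `∃ C₃ ε₈ > 0` such that on EVERY lattice, for every `U` of E162's data with `‖U(b) − 1‖ ≤ ε ≤ ε₈` and `hRS`,
  for ANY positivity / surjectivity witnesses at `U` and at `1`: `‖𝔊(U)x − 𝔊(1)x‖ ≤ C₃·ε·‖x‖` for the chain's `frakGLatticeK` — the owner's conclusion
  VERBATIM; telescoping by `B9Eq386ResolventLetters.norm_frakG_formula_sub_le`.
MODEL / DECLARED READINGS.  (M1) one averaging step on `TSite d (L·m)`, weights `c₀, c₁`, Hilbert fibre `W` read in `𝔸`; the flat point only; `L²` operator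
norms.  (M2) no hypothesis of the papers displayed.  (M3) NOT HERE: uniformity in the SPACING `η` or in `L`, analyticity in `A`, two general small fields,
the chart's Banach norms ((N)/(K)).
HONEST SCOPE.  Restatement class; the proof text is the OWNER t4-ne9-p1 gen 81's, re-plugged (attributed); «NE9 ⇐ the named binders»; NOT summit progress
(cell pub-balaban: NE9 NOT PRINTED ∕ NOT PROVED; spine PROVED 0∕9; rung (B)+1 finite T⁴ — NOT infinite volume, NOT mass gap, NOT Clay; HONEST DEPENDENCY:
continuum YM on T⁴ ⇐ BetaPertH ∧ nine spine estimates (0/9 proved); BetaPertH ⇐ (D1) ∧ (D4) ∧ CAP+tail; G-an2-4 gates asym, D1 and NE2/3/4).  Unit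
`b2b-balaban-t4-ne9-formalise-leaf-04` (NE9 crux-team leaf prover, gen 71), INTENT I-ne9leaf04-g71-2 item (Q3′); NEW file importing
`B9Eq386LipschitzH1Uniform`, `B9Eq368RLipschitzUniform`, `B9Eq368ProjectionRemainder`, `B9Eq373DerivativeRemainderL2`; modifies nothing.  Net new unproved facts: 0.
-/

noncomputable section

open scoped InnerProductSpace ComplexConjugate

namespace Literature.MathematicalPhysics.QuantumFieldTheory.Balaban1983to89.B9Eq3153FrakGLipschitzUniform

open B4Sect5Torus (TSite)
open B9SectCLatticeCarrier (Bond)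
open B7Prop1Explicit (U1 Wcx boxVec)
open B9Eq311L2Pairing (WL2)
open B9Eq319QprimeTorus (fineP)
open B11Eq103H1Complex (SiteL2K BondL2K covDerivL2K covDivL2K laplaceAK laplaceALatticeK H1LatticeK G1LatticeK KinvLatticeK frakGLatticeK RLatticeK
  greenK G1K)
open B9Eq310HessianOperator (adTransportW hessOp)
open B9Eq326OperatorAssembly (RofU)
open B9Eq315QTorus (perCfg cornerSite QtorusW laplaceAofBackground)
open B9Eq315QTorusOnto (liftSite perSite_liftSite QtorusW_surjective)
open B5Eq172FlatCoercivity (hU1_one hreg_one)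
open B9Eq368ProjectionRemainder (norm_projR_le)
open B9Eq373DerivativeRemainderL2 (norm_covDerivL2K_sub_le norm_covDerivL2K_le norm_covDivL2K_sub_le norm_covDivL2K_le)
open B9Eq384RemainderLetters (adTransportW_one_apply adTransportW_one_inv_apply hRS_one norm_adTransportW_sub_le)
open B9Eq383QSemiLocal (norm_QtorusW_sub_flat_le_local)
open B9Eq315QFlatNorm (norm_QtorusW_one_le)
open B9Thm311SmallFieldClosedUniform (norm_G1_le_of_small_field_uniform)
open B9Eq3126H1BoundUniform (exists_H1_frakG_bound_of_small_field_uniform)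
open B9Eq386ResolventLetters (norm_frakG_formula_sub_le)
open B9Eq386LipschitzH1Uniform (exists_lipschitz_G1_H1_at_flat_uniform)
open B9Eq368RLipschitzUniform (exists_RofU_sub_flat_linear_uniform)

variable {d : ℕ} (L : ℕ) [NeZero L] (hL : 1 ≤ L)
  {𝔸 : Type*} [NormedRing 𝔸] [NormedAlgebra ℂ 𝔸] [CompleteSpace 𝔸] [NormOneClass 𝔸] [StarRing 𝔸] [NormedStarGroup 𝔸] [StarModule ℂ 𝔸]
  {W : Type*} [NormedAddCommGroup W] [InnerProductSpace ℂ W] [FiniteDimensional ℂ W] (φ : W ≃ₗ[ℂ] 𝔸) {c₀ c₁ : ℝ} [Fact (0 < c₀)] [Fact (0 < c₁)]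

set_option maxHeartbeats 800000 in
/-- **`𝔊(U)` ((3.153)/(111)) IS LIPSCHITZ IN THE BACKGROUND AT THE FLAT POINT WITH `C₃, ε₈` INDEPENDENT OF THE VOLUME:
`‖𝔊(U)x − 𝔊(1)x‖ ≤ C₃·ε·‖x‖`** for the chain's `frakGLatticeK` (ANY witnesses at `U` and at `1`), on EVERY lattice `TSite d (L·m)`, at every background
of E162's data with `‖U(b) − 1‖ ≤ ε ≤ ε₈` and `hRS`.  The owner's `exists_lipschitz_frakG_at_flat` with the volume INSIDE: `‖G₁‖ ≤ γ₁⁻¹` by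
`norm_G1_le_of_small_field_uniform` ((E′)), `‖H₁(1)‖ ≤ C_H` by `exists_H1_frakG_bound_of_small_field_uniform` ((H2′)), `δ_G, δ_H` by
`exists_lipschitz_G1_H1_at_flat_uniform` ((Q2′)), `δ_R` by `exists_RofU_sub_flat_linear_uniform` ((Q3a′)), `δ_Q = C_Q·ε` by
`norm_QtorusW_sub_flat_le_local`, `‖Q(1)‖ ≤ M_φ′M_φ√(c₁/(c₀L^d))` by `norm_QtorusW_one_le`; `‖D‖, ‖D*‖ ≤ 4|η|⁻¹√d`, `δ_D = |η|⁻¹·2M_φM_φ′ε·√d`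
(`B9Eq373DerivativeRemainderL2`), `‖R‖ ≤ 1` (`B9Eq368ProjectionRemainder.norm_projR_le`); telescoping `B9Eq386ResolventLetters.norm_frakG_formula_sub_le`.
[cite: Balaban1985BackgroundPropagators, (3.153) p.426, (3.147) p.425, Thm 3.4 p.400, (3.86) p.407, Thm 3.11 p.416; Balaban1985Variational, (110)–(111) p.294] -/
theorem exists_lipschitz_frakG_at_flat_uniform {η : ℝ} (hη : η ≠ 0) {a : ℝ} (ha : 0 < a) {Mφ Mφ' : ℝ} (hMφ : 0 ≤ Mφ) (hMφ' : 0 ≤ Mφ')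
    (hφ : ∀ w, ‖φ w‖ ≤ Mφ * ‖w‖) (hφ' : ∀ X, ‖φ.symm X‖ ≤ Mφ' * ‖X‖) (τ : 𝔸 →ₗ[ℂ] ℂ) {Cτ : ℝ} (hτ : ∀ X, ‖τ X‖ ≤ Cτ * ‖X‖) (hCτ : 0 ≤ Cτ) :
    ∃ C₃ ε₈ : ℝ, 0 < C₃ ∧ 0 < ε₈ ∧ ∀ (m : Fin d → ℕ) [∀ i, NeZero (fineP L m i)] (U : Bond d (fineP L m) → 𝔸ˣ) {α : ℝ} (hα1 : α ≤ 1 / 64)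
      (hU1 : ∀ (x : B7Prop1Explicit.Site d) (κ : Fin d), perCfg (fineP L m) U x κ ∈ U1 𝔸)
      (hreg : ∀ (y : TSite d m) (κ : Fin d) (r : Fin d → Fin L), ‖((Wcx L (perCfg (fineP L m) U) (cornerSite L y) κ (boxVec L r) : 𝔸ˣ) : 𝔸) - 1‖ ≤ α)
      {ε : ℝ}, 0 ≤ ε → ε ≤ ε₈ → (∀ b, ‖(U b : 𝔸) - 1‖ ≤ ε) →
      (∀ (b : Bond d (fineP L m)) (v u : W), ⟪adTransportW φ U b v, u⟫_ℂ = ⟪v, adTransportW φ (fun b => (U b)⁻¹) b u⟫_ℂ) →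
      ∀ (hpos : ∀ x : BondL2K ℂ d (fineP L m) c₀ W, x ≠ 0 →
          0 < RCLike.re ⟪x, laplaceAofBackground L m hL φ U hα1 hU1 hreg τ η (c₀ := c₀) (c₁ := c₁) a x⟫_ℂ)
        (hQ : Function.Surjective (QtorusW L m hL φ U hα1 hU1 hreg (c₀ := c₀) (c₁ := c₁)))
        (hpos₁ : ∀ x : BondL2K ℂ d (fineP L m) c₀ W, x ≠ 0 →
          0 < RCLike.re ⟪x, laplaceAofBackground L m hL φ (fun _ => 1) (show (0 : ℝ) ≤ 1 / 64 by norm_num) (hU1_one L m) (hreg_one L m) τ η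
            (c₀ := c₀) (c₁ := c₁) a x⟫_ℂ)
        (hQ₁ : Function.Surjective (QtorusW L m hL φ (fun _ => 1) (show (0 : ℝ) ≤ 1 / 64 by norm_num) (hU1_one L m) (hreg_one L m)
          (c₀ := c₀) (c₁ := c₁))) (x : BondL2K ℂ d (fineP L m) c₀ W),
      ‖frakGLatticeK (Δ₁ := hessOp φ η U τ) (Q := QtorusW L m hL φ U hα1 hU1 hreg (c₀ := c₀) (c₁ := c₁)) hpos hQ x -
          frakGLatticeK (Δ₁ := hessOp φ η (fun _ => 1) τ)
            (Q := QtorusW L m hL φ (fun _ => 1) (show (0 : ℝ) ≤ 1 / 64 by norm_num) (hU1_one L m) (hreg_one L m) (c₀ := c₀) (c₁ := c₁)) hpos₁ hQ₁ x‖ ≤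
        C₃ * ε * ‖x‖ := by
  have hc₀ : 0 < c₀ := Fact.out
  have hc : conj ((η : ℂ))⁻¹ = ((η : ℂ))⁻¹ := by rw [map_inv₀, Complex.conj_ofReal]
  -- the uniform coercivity of `Δ_a` (for `‖G₁‖ ≤ γ₁⁻¹`), the uniform bound of `H₁` (used at `1`), the Lipschitz letters of `G₁`/`H₁` and of `R`
  obtain ⟨γ₁, ε₃, hγ₁, hε₃, HG⟩ := norm_G1_le_of_small_field_uniform L hL φ (c₀ := c₀) (c₁ := c₁) hη ha hMφ hMφ' hφ hφ' τ hτ hCτ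
  obtain ⟨CH, CG', ε₅, hCH, -, hε₅, Hb⟩ := exists_H1_frakG_bound_of_small_field_uniform L hL φ (c₀ := c₀) (c₁ := c₁) hη ha hMφ hMφ' hφ hφ' τ hτ hCτ
  obtain ⟨C₁, C₂, ε₇, hC₁, hC₂, hε₇, HGH⟩ := exists_lipschitz_G1_H1_at_flat_uniform L hL φ (c₀ := c₀) (c₁ := c₁) hη ha hMφ hMφ' hφ hφ' τ hτ hCτ
  obtain ⟨CR, εR₀, hCR, hεR₀, HR⟩ := exists_RofU_sub_flat_linear_uniform L φ (c₀ := c₀) hη hMφ hMφ' hφ hφ'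
  -- constants
  have hc₁ : 0 < c₁ := Fact.out
  have hL0 : (0 : ℝ) < L := by exact_mod_cast Nat.pos_of_ne_zero (NeZero.ne L)
  obtain ⟨MQ1, hMQ1def⟩ : ∃ MQ1 : ℝ, MQ1 = Mφ' * Mφ * Real.sqrt (c₁ / (c₀ * (L : ℝ) ^ d)) := ⟨_, rfl⟩
  have hMQ1 : 0 ≤ MQ1 := by rw [hMQ1def]; positivity
  obtain ⟨KR, hKRdef⟩ : ∃ KR : ℝ, KR = 2 * Mφ * Mφ' := ⟨_, rfl⟩
  have hKR : 0 ≤ KR := by rw [hKRdef]; positivity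
  obtain ⟨CQ, hCQdef⟩ : ∃ CQ : ℝ, CQ = Mφ' * Mφ * Real.sqrt (2 * d * c₁ / c₀) * (102 * (d + 1) ^ 2 * L) := ⟨_, rfl⟩
  have hCQ : 0 ≤ CQ := by rw [hCQdef]; positivity
  obtain ⟨MD, hMDdef⟩ : ∃ MD : ℝ, MD = 2 * (1 + 1) * ‖((η : ℂ))⁻¹‖ * Real.sqrt d := ⟨_, rfl⟩
  have hMD : 0 ≤ MD := by rw [hMDdef]; positivity
  obtain ⟨KD, hKDdef⟩ : ∃ KD : ℝ, KD = ‖((η : ℂ))⁻¹‖ * KR * Real.sqrt d := ⟨_, rfl⟩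
  have hKD : 0 ≤ KD := by rw [hKDdef]; positivity
  refine ⟨C₁ + (C₂ * (MQ1 + CQ) * γ₁⁻¹ + CH * CQ * γ₁⁻¹ + CH * (MQ1 + CQ) * C₁) +
      (C₁ * MD * MD * γ₁⁻¹ + γ₁⁻¹ * KD * MD * γ₁⁻¹ + γ₁⁻¹ * MD * CR * MD * γ₁⁻¹ + γ₁⁻¹ * MD * KD * γ₁⁻¹ + γ₁⁻¹ * MD * MD * C₁),
    min ε₃ (min (1 / (KR + 1)) (min 1 (min ε₅ (min ε₇ εR₀)))), by positivity, by positivity, ?_⟩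
  intro m _ U α hα1 hU1 hreg ε hε hε₈ hUε hRS hpos hQs hpos₁ hQs₁ x
  have hQ1 : ∀ x : BondL2K ℂ d (fineP L m) c₀ W,
      ‖QtorusW L m hL φ (fun _ => 1) (show (0 : ℝ) ≤ 1 / 64 by norm_num) (hU1_one L m) (hreg_one L m) (c₀ := c₀) (c₁ := c₁) x‖ ≤ MQ1 * ‖x‖ :=
    fun x => by
      rw [hMQ1def]
      exact norm_QtorusW_one_le L m hL (show (0 : ℝ) ≤ 1 / 64 by norm_num) (hU1_one L m) (hreg_one L m) φ hMφ hφ hMφ' hφ' x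
  have hεε₃ : ε ≤ ε₃ := hε₈.trans (min_le_left _ _)
  have hε1' : ε ≤ 1 / (KR + 1) := hε₈.trans ((min_le_right _ _).trans (min_le_left _ _))
  have hε1 : ε ≤ 1 := hε₈.trans ((min_le_right _ _).trans ((min_le_right _ _).trans (min_le_left _ _)))
  have hεε₇ : ε ≤ ε₇ := hε₈.trans ((min_le_right _ _).trans ((min_le_right _ _).trans ((min_le_right _ _).trans ((min_le_right _ _).trans (min_le_left _ _)))))
  have hεεR₀ : ε ≤ εR₀ := hε₈.trans ((min_le_right _ _).trans ((min_le_right _ _).trans ((min_le_right _ _).trans ((min_le_right _ _).trans (min_le_right _ _)))))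
  have hεR1 : KR * ε ≤ 1 := by
    refine (mul_le_mul_of_nonneg_left hε1' hKR).trans ?_
    rw [mul_one_div, div_le_one (by positivity)]; linarith
  -- the bond variables: `U(b) ∈ U1`, transporters `εR`-close to the identity
  have hUb : ∀ b : Bond d (fineP L m), U b ∈ U1 𝔸 := fun b => by
    obtain ⟨y, κ⟩ := b
    have h := hU1 (liftSite y) κ
    rwa [B9Eq315QTorus.perCfg_apply, perSite_liftSite] at h
  have hR : ∀ (b : Bond d (fineP L m)) (w : W), ‖adTransportW φ U b w - w‖ ≤ KR * ε * ‖w‖ := fun b w => by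
    have h := norm_adTransportW_sub_le φ hφ hφ' hMφ' U b (hUb b) (hUε b) w
    rw [hKRdef]; linarith
  have hR1 : ∀ (b : Bond d (fineP L m)) (w : W), ‖adTransportW φ U b w - w‖ ≤ 1 * ‖w‖ := fun b w =>
    (hR b w).trans (mul_le_mul_of_nonneg_right hεR1 (norm_nonneg _))
  have hR₁ : ∀ (b : Bond d (fineP L m)) (w : W), adTransportW φ (fun _ : Bond d (fineP L m) => (1 : 𝔸ˣ)) b w = w :=
    adTransportW_one_apply L m φ
  have hS₁ : ∀ (b : Bond d (fineP L m)) (w : W), adTransportW φ (fun _ : Bond d (fineP L m) => (1 : 𝔸ˣ)⁻¹) b w = w :=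
    adTransportW_one_inv_apply L m φ
  have hR₁1 : ∀ (b : Bond d (fineP L m)) (w : W), ‖adTransportW φ (fun _ : Bond d (fineP L m) => (1 : 𝔸ˣ)) b w - w‖ ≤ 1 * ‖w‖ :=
    fun b w => by rw [hR₁, sub_self, norm_zero]; positivity
  have hRS₁ := hRS_one L m φ (𝔸 := 𝔸)
  have hU0 : ∀ b : Bond d (fineP L m), ‖(((fun _ => (1 : 𝔸ˣ)) b : 𝔸ˣ) : 𝔸) - 1‖ ≤ (0 : ℝ) := fun b => by simp
  -- the letters' BOUNDS
  have hG₁le : ∀ z : BondL2K ℂ d (fineP L m) c₀ W,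
      ‖G1LatticeK (Δ₁ := hessOp φ η U τ) (Q := QtorusW L m hL φ U hα1 hU1 hreg (c₀ := c₀) (c₁ := c₁)) hpos z‖ ≤ γ₁⁻¹ * ‖z‖ :=
    fun z => HG m U hα1 hU1 hreg hε hεε₃ hUε hRS hpos z
  have hG₂le : ∀ z : BondL2K ℂ d (fineP L m) c₀ W,
      ‖G1LatticeK (Δ₁ := hessOp φ η (fun _ => 1) τ)
        (Q := QtorusW L m hL φ (fun _ => 1) (show (0 : ℝ) ≤ 1 / 64 by norm_num) (hU1_one L m) (hreg_one L m) (c₀ := c₀) (c₁ := c₁)) hpos₁ z‖ ≤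
        γ₁⁻¹ * ‖z‖ :=
    fun z => HG m (fun _ => 1) (show (0 : ℝ) ≤ 1 / 64 by norm_num) (hU1_one L m) (hreg_one L m) le_rfl hε₃.le hU0 hRS₁ hpos₁ z
  have hH₂le : ∀ b : BondL2K ℂ d m c₁ W,
      ‖H1LatticeK (Δ₁ := hessOp φ η (fun _ => 1) τ)
        (Q := QtorusW L m hL φ (fun _ => 1) (show (0 : ℝ) ≤ 1 / 64 by norm_num) (hU1_one L m) (hreg_one L m) (c₀ := c₀) (c₁ := c₁)) hpos₁ hQs₁ b‖ ≤
        CH * ‖b‖ :=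
    fun b => (Hb m (fun _ => 1) (show (0 : ℝ) ≤ 1 / 64 by norm_num) (hU1_one L m) (hreg_one L m) le_rfl hε₅.le hU0 hRS₁ hpos₁ hQs₁).1 b
  have hQdiff : ∀ x : BondL2K ℂ d (fineP L m) c₀ W, ‖QtorusW L m hL φ U hα1 hU1 hreg (c₁ := c₁) x -
      QtorusW L m hL φ (fun _ => 1) (show (0 : ℝ) ≤ 1 / 64 by norm_num) (hU1_one L m) (hreg_one L m) (c₁ := c₁) x‖ ≤ CQ * ε * ‖x‖ := fun x => by
    refine (norm_QtorusW_sub_flat_le_local L m hL U hα1 hU1 hreg (show (0 : ℝ) ≤ 1 / 64 by norm_num) (hU1_one L m) (hreg_one L m) hε hUε φ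
      hMφ hφ hMφ' hφ' x).trans (le_of_eq ?_)
    rw [hCQdef]; ring
  have hQU : ∀ x : BondL2K ℂ d (fineP L m) c₀ W, ‖QtorusW L m hL φ U hα1 hU1 hreg (c₀ := c₀) (c₁ := c₁) x‖ ≤ (MQ1 + CQ) * ‖x‖ := fun x => by
    have h1 := hQ1 x
    have h2 := hQdiff x
    have h3 := norm_le_insert' (QtorusW L m hL φ U hα1 hU1 hreg (c₀ := c₀) (c₁ := c₁) x)
      (QtorusW L m hL φ (fun _ => 1) (show (0 : ℝ) ≤ 1 / 64 by norm_num) (hU1_one L m) (hreg_one L m) (c₀ := c₀) (c₁ := c₁) x)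
    have h4 : CQ * ε * ‖x‖ ≤ CQ * ‖x‖ := mul_le_mul_of_nonneg_right (mul_le_of_le_one_right hCQ hε1) (norm_nonneg x)
    linarith
  have hQ1' : ∀ x : BondL2K ℂ d (fineP L m) c₀ W,
      ‖QtorusW L m hL φ (fun _ => 1) (show (0 : ℝ) ≤ 1 / 64 by norm_num) (hU1_one L m) (hreg_one L m) (c₀ := c₀) (c₁ := c₁) x‖ ≤ (MQ1 + CQ) * ‖x‖ :=
    fun x => (hQ1 x).trans (mul_le_mul_of_nonneg_right (le_add_of_nonneg_right hCQ) (norm_nonneg x))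
  have hD₁le : ∀ s : SiteL2K ℂ d (fineP L m) c₀ W, ‖covDerivL2K ℂ c₀ ((η : ℂ))⁻¹ (adTransportW φ U) s‖ ≤ MD * ‖s‖ := fun s => by
    rw [hMDdef]; exact norm_covDerivL2K_le _ zero_le_one hR1 s
  have hD₂le : ∀ s : SiteL2K ℂ d (fineP L m) c₀ W, ‖covDerivL2K ℂ c₀ ((η : ℂ))⁻¹ (adTransportW φ fun _ => 1) s‖ ≤ MD * ‖s‖ := fun s => by
    rw [hMDdef]; exact norm_covDerivL2K_le _ zero_le_one hR₁1 s
  have hDs₁le : ∀ x : BondL2K ℂ d (fineP L m) c₀ W, ‖covDivL2K ℂ c₀ ((η : ℂ))⁻¹ (adTransportW φ fun b => (U b)⁻¹) x‖ ≤ MD * ‖x‖ := fun x => by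
    rw [hMDdef]; exact norm_covDivL2K_le _ hc zero_le_one hR1 hRS x
  have hDs₂le : ∀ x : BondL2K ℂ d (fineP L m) c₀ W,
      ‖covDivL2K ℂ c₀ ((η : ℂ))⁻¹ (adTransportW φ fun b => ((fun _ => (1 : 𝔸ˣ)) b)⁻¹) x‖ ≤ MD * ‖x‖ := fun x => by
    rw [hMDdef]; exact norm_covDivL2K_le _ hc zero_le_one hR₁1 hRS₁ x
  have hRr₁ : ∀ s : SiteL2K ℂ d (fineP L m) c₀ W, ‖RofU L m φ η U s‖ ≤ ‖s‖ := fun s => by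
    unfold RofU RLatticeK; exact norm_projR_le _ _ s
  have hRr₂ : ∀ s : SiteL2K ℂ d (fineP L m) c₀ W, ‖RofU L m φ η (fun _ => 1) s‖ ≤ ‖s‖ := fun s => by
    unfold RofU RLatticeK; exact norm_projR_le _ _ s
  -- the letters' DIFFERENCES
  obtain ⟨hGsub, hHsub⟩ := HGH m U hα1 hU1 hreg hε hεε₇ hUε hRS hpos hQs hpos₁ hQs₁
  have hQsub : ∀ x : BondL2K ℂ d (fineP L m) c₀ W, ‖QtorusW L m hL φ U hα1 hU1 hreg (c₀ := c₀) (c₁ := c₁) x -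
      QtorusW L m hL φ (fun _ => 1) (show (0 : ℝ) ≤ 1 / 64 by norm_num) (hU1_one L m) (hreg_one L m) (c₀ := c₀) (c₁ := c₁) x‖ ≤ CQ * ε * ‖x‖ := hQdiff
  have hDsub : ∀ s : SiteL2K ℂ d (fineP L m) c₀ W,
      ‖covDerivL2K ℂ c₀ ((η : ℂ))⁻¹ (adTransportW φ U) s - covDerivL2K ℂ c₀ ((η : ℂ))⁻¹ (adTransportW φ fun _ => 1) s‖ ≤ KD * ε * ‖s‖ := fun s => by
    have h := norm_covDerivL2K_sub_le ((η : ℂ))⁻¹ (show 0 ≤ KR * ε by positivity) hR hR₁ s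
    rw [hKDdef]; refine h.trans (le_of_eq ?_); ring
  have hDssub : ∀ x : BondL2K ℂ d (fineP L m) c₀ W,
      ‖covDivL2K ℂ c₀ ((η : ℂ))⁻¹ (adTransportW φ fun b => (U b)⁻¹) x - covDivL2K ℂ c₀ ((η : ℂ))⁻¹ (adTransportW φ fun b => ((fun _ => (1 : 𝔸ˣ)) b)⁻¹) x‖ ≤
        KD * ε * ‖x‖ := fun x => by
    have h := norm_covDivL2K_sub_le ((η : ℂ))⁻¹ hc (show 0 ≤ KR * ε by positivity) hR hR₁ hRS hS₁ x
    rw [hKDdef]; refine h.trans (le_of_eq ?_); ring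
  have hRsub : ∀ s : SiteL2K ℂ d (fineP L m) c₀ W, ‖RofU L m φ η U s - RofU L m φ η (fun _ => 1) s‖ ≤ CR * ε * ‖s‖ :=
    fun s => HR m U hε hεεR₀ hUb hUε hRS s
  -- the two `𝔊`'s in the form of the telescoping lemma (`H₁ = G₁Q†K⁻¹` by `rfl`)
  have e₁ : frakGLatticeK (Δ₁ := hessOp φ η U τ) (Q := QtorusW L m hL φ U hα1 hU1 hreg (c₀ := c₀) (c₁ := c₁)) hpos hQs x =
      G1LatticeK (Δ₁ := hessOp φ η U τ) (Q := QtorusW L m hL φ U hα1 hU1 hreg (c₀ := c₀) (c₁ := c₁)) hpos x -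
        H1LatticeK (Δ₁ := hessOp φ η U τ) (Q := QtorusW L m hL φ U hα1 hU1 hreg (c₀ := c₀) (c₁ := c₁)) hpos hQs
          (QtorusW L m hL φ U hα1 hU1 hreg (c₀ := c₀) (c₁ := c₁)
            (G1LatticeK (Δ₁ := hessOp φ η U τ) (Q := QtorusW L m hL φ U hα1 hU1 hreg (c₀ := c₀) (c₁ := c₁)) hpos x)) -
        G1LatticeK (Δ₁ := hessOp φ η U τ) (Q := QtorusW L m hL φ U hα1 hU1 hreg (c₀ := c₀) (c₁ := c₁)) hpos
          (covDerivL2K ℂ c₀ ((η : ℂ))⁻¹ (adTransportW φ U) (RofU L m φ η U (covDivL2K ℂ c₀ ((η : ℂ))⁻¹ (adTransportW φ fun b => (U b)⁻¹)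
            (G1LatticeK (Δ₁ := hessOp φ η U τ) (Q := QtorusW L m hL φ U hα1 hU1 hreg (c₀ := c₀) (c₁ := c₁)) hpos x)))) := by
    unfold frakGLatticeK
    rw [B11Eq111FrakG.frakGLin_apply]
    rfl
  have e₂ : frakGLatticeK (Δ₁ := hessOp φ η (fun _ => 1) τ)
        (Q := QtorusW L m hL φ (fun _ => 1) (show (0 : ℝ) ≤ 1 / 64 by norm_num) (hU1_one L m) (hreg_one L m) (c₀ := c₀) (c₁ := c₁)) hpos₁ hQs₁ x =
      G1LatticeK (Δ₁ := hessOp φ η (fun _ => 1) τ)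
          (Q := QtorusW L m hL φ (fun _ => 1) (show (0 : ℝ) ≤ 1 / 64 by norm_num) (hU1_one L m) (hreg_one L m) (c₀ := c₀) (c₁ := c₁)) hpos₁ x -
        H1LatticeK (Δ₁ := hessOp φ η (fun _ => 1) τ)
          (Q := QtorusW L m hL φ (fun _ => 1) (show (0 : ℝ) ≤ 1 / 64 by norm_num) (hU1_one L m) (hreg_one L m) (c₀ := c₀) (c₁ := c₁)) hpos₁ hQs₁
          (QtorusW L m hL φ (fun _ => 1) (show (0 : ℝ) ≤ 1 / 64 by norm_num) (hU1_one L m) (hreg_one L m) (c₀ := c₀) (c₁ := c₁)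
            (G1LatticeK (Δ₁ := hessOp φ η (fun _ => 1) τ)
              (Q := QtorusW L m hL φ (fun _ => 1) (show (0 : ℝ) ≤ 1 / 64 by norm_num) (hU1_one L m) (hreg_one L m) (c₀ := c₀) (c₁ := c₁)) hpos₁ x)) -
        G1LatticeK (Δ₁ := hessOp φ η (fun _ => 1) τ)
          (Q := QtorusW L m hL φ (fun _ => 1) (show (0 : ℝ) ≤ 1 / 64 by norm_num) (hU1_one L m) (hreg_one L m) (c₀ := c₀) (c₁ := c₁)) hpos₁
          (covDerivL2K ℂ c₀ ((η : ℂ))⁻¹ (adTransportW φ fun _ => 1) (RofU L m φ η (fun _ => 1)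
            (covDivL2K ℂ c₀ ((η : ℂ))⁻¹ (adTransportW φ fun b => ((fun _ => (1 : 𝔸ˣ)) b)⁻¹)
              (G1LatticeK (Δ₁ := hessOp φ η (fun _ => 1) τ)
                (Q := QtorusW L m hL φ (fun _ => 1) (show (0 : ℝ) ≤ 1 / 64 by norm_num) (hU1_one L m) (hreg_one L m) (c₀ := c₀) (c₁ := c₁))
                hpos₁ x)))) := by
    unfold frakGLatticeK
    rw [B11Eq111FrakG.frakGLin_apply]
    rfl
  rw [e₁, e₂]
  refine (norm_frakG_formula_sub_le (𝕜 := ℂ) _ _ _ _ _ _ _ _ _ _ _ _ (by positivity) hCH.le (by positivity) hMD (by positivity) (by positivity)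
    (by positivity) (by positivity) (by positivity) hG₁le hG₂le hH₂le hQU hQ1' hD₁le hD₂le hDs₁le hDs₂le hRr₁ hRr₂ hGsub hHsub hQsub hDsub
    hDssub hRsub x).trans (le_of_eq ?_)
  ring

end Literature.MathematicalPhysics.QuantumFieldTheory.Balaban1983to89.B9Eq3153FrakGLipschitzUniform

end
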